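import Literature.MathematicalPhysics.QuantumFieldTheory.Balaban1983to89.B11Thm1ExistsUniqueStepTokensG

/-!
# `Balaban1983to89.B11Thm1ExistsUniqueStepTokensGBridges` — [Balaban1985Variational] = «[15]», Theorem 1 p. 279 (existence ∕ uniqueness half): THE PROVED REDUCTIONS between the
# guard-generic (E∕U) named fact `B11Thm1ExistsUniqueCoP7MG.VariationalThm1EUSep{Top,CoP}7MG` (#10741), K0's (R)-name `Node00.VariationalThm1RegSep{Top,CoP}7MG`, and the two tokens
# of the sibling STATEMENT-ONLY module `B11Thm1ExistsUniqueStepTokensG` — the one-length step «given an approximate minimiser with (14)» and the supply «an approximate minimiser exists»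

Honest framing: statement-level skeleton of published theorems with citation tags; proofs where landed; nothing here is a claim about the Yang–Mills mass gap.  Cell `pub-ymgap`
(HUMAN RULINGS D-0062 ∕ D-0149), lane `pub-ymgap-dag-n12-c` g33 (R134 seat (a), N12 = [B15], s1); `--kind proof --supports` K1⁹ `stmt-QuantumFields-27364`; count-neutral; N12 NOT
discharged; finite 𝕋⁴ at fixed ε; nothing continuum ∕ ℝ⁴ ∕ OS ∕ mass-gap ∕ Clay.  THEOREMS ONLY (0 `def`, 0 `instance`, 0 `sorry`) — kept OUT of the token module so that one stays in
the statement-only lane (the pattern of `B11Thm1ExistsUniqueCoP7MGBridges` next to `B11Thm1ExistsUniqueCoP7MG`).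

CONTENTS.
* §1 the (14) accessors `ApproxMinTop.plaq ∕ .coDiv ∕ .agree`, monotonicity `ApproxMinTop.of_le`, and ★ `approxMinTop_of_reg` (a `B₃δ_n`-REGULAR configuration agreeing with the
  datum is an approximate minimiser at every `ρ_n ≥ B₃δ_n` — the shape in which (8) feeds (14), print's (13)).
* §2 ★★ `variationalThm1EUSepTop7MG_of_step_of_approxExists` ∕ `…CoP7MG…` — THE (E∕U) NAME FROM THE STEP TOKEN AND THE SUPPLY TOKEN, pointwise in `(s, W)` (print's proof of
  Theorem 1's existence ∕ uniqueness half in one line: apply Sects. A–E around the approximate minimiser the induction supplies); ★ `approxMinimiserExistsTop7MG_of_eu_of_reg` ∕ `…CoP…`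
  (the converse bookkeeping: a minimiser, `B₃δ_n`-regular by (R), IS an approximate minimiser, any `C₁ ≥ 1`); ★ `variationalThm1EUSepTop7MG_iff_approxExists_of_step_of_reg` ∕ `…CoP…`
  (MODULO the step token and (R), the name ⟺ the supply token: everything in Theorem 1 (E∕U) beyond the one-length analysis is the supply of approximate minimisers = print's induction
  (11)–(13)); bookkeeping `.anti` (antitone in the guard), `.of_le` (antitone in the ceilings `a₀ a₁`), `VariationalThm1EUStep….of_C₁_le` (antitone in `C₁`),
  `ApproxMinimiserExists….mono` (monotone in `C₁`), `….anti`.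

HONEST SCOPE.  Implications between NAMED `Prop`s none of which is asserted or produced in the tree (producers = an N07 ∕ NODE-00 obligation: [15] Props 2–7 for the step token,
(11)–(13) + the interface-solvability note (ℓ2) of the token module for the supply token); nothing of Bałaban's analysis asserted; count-neutral; K0⁷ ∕ K1⁹ NOT closed; N12 NOT
discharged; the YM mass gap (Clay) is NOT proved by any of this.
-/

noncomputable section

namespace Literature.MathematicalPhysics.QuantumFieldTheory.Balaban1983to89.B11Thm1ExistsUniqueStepTokensG

open T4Continuum B15DeterminingSets GaugeField Node00
open B16Sect1Backgrounds (toMS)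
open B11Thm1ExistsUniqueCoP7MG (VariationalThm1EUSepTop7MG VariationalThm1EUSepCoP7MG)

/-! ## §1  (14): accessors, monotonicity, «regular + agreeing ⇒ approximate minimiser» -/

section Approx

variable {P : Params} {N : ℕ} [NeZero N]

/-- `0 ≤ η_n` on the lattices of record. [cite: Balaban1987RG1, (1.1) p.260 (bookkeeping)] -/
private theorem eta_nonneg' (P : Params) (n : ℕ) : 0 ≤ P.eta n := by
  unfold Params.eta
  exact pow_nonneg (inv_nonneg.mpr (Nat.cast_nonneg _)) n

namespace ApproxMinTop

variable {av : ∀ j, Averaging P j (SU N)} {Ω : ℕ → Set (Site P 0)} {Ω₀ : Set (Site P 0)} {k : ℕ} {ρ ρ' : ℕ → ℝ} {W : MSField P (SU N)}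
  {U₀ : GaugeField P 0 (SU N)}

/-- The plaquette clause of (14). [cite: Balaban1985Variational, (14) p.280 (bookkeeping)] -/
theorem plaq (h : ApproxMinTop av Ω Ω₀ k ρ W U₀) {n : ℕ} (hn : n ≤ k) : PlaqSmallOn (Sect2.omegaPlaqsTop Ω Ω₀ n) (ρ n * P.eta n ^ 2) U₀ := h.1 n hn

/-- The co-divergence clause of (14). [cite: Balaban1985Variational, (14) p.280 (bookkeeping)] -/
theorem coDiv (h : ApproxMinTop av Ω Ω₀ k ρ W U₀) {n : ℕ} (hn : n ≤ k) : Sect2.CoDivSmallOn (Sect2.omegaBondsTop Ω Ω₀ n) (ρ n * P.eta n ^ 3) U₀ := h.2.1 n hn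

/-- The agreement clause of (14). [cite: Balaban1985Variational, (14) p.280 (bookkeeping)] -/
theorem agree (h : ApproxMinTop av Ω Ω₀ k ρ W U₀) : AgreeOn (genSet Ω k) (avgFamily av U₀) W := h.2.2

/-- (14) is MONOTONE in the regularity thresholds. [cite: Balaban1985Variational, (14) p.280 (bookkeeping)] -/
theorem of_le (h : ApproxMinTop av Ω Ω₀ k ρ W U₀) (hρ : ∀ n, n ≤ k → ρ n ≤ ρ' n) : ApproxMinTop av Ω Ω₀ k ρ' W U₀ := by
  refine ⟨fun n hn p hp => (h.1 n hn p hp).trans_le ?_, fun n hn => (h.2.1 n hn).of_le ?_, h.2.2⟩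
  · exact mul_le_mul_of_nonneg_right (hρ n hn) (pow_nonneg (eta_nonneg' P n) 2)
  · exact mul_le_mul_of_nonneg_right (hρ n hn) (pow_nonneg (eta_nonneg' P n) 3)

end ApproxMinTop

/-- **A MINIMISER IS AN APPROXIMATE MINIMISER**: a configuration agreeing with `W` on `genSet Ω k` and `B₃δ_n`-regular in the sense of (8) satisfies (14) at every `ρ_n ≥ B₃δ_n`.
[cite: Balaban1985Variational, Thm 1 (8) p.279, (14) p.280] -/
theorem approxMinTop_of_reg {av : ∀ j, Averaging P j (SU N)} {Ω : ℕ → Set (Site P 0)} {Ω₀ : Set (Site P 0)} {k : ℕ} {B₃ : ℝ} {δ ρ : ℕ → ℝ}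
    {W : MSField P (SU N)} {U₀ : GaugeField P 0 (SU N)} (hagree : AgreeOn (genSet Ω k) (avgFamily av U₀) W)
    (h8 : (∀ n, n ≤ k → PlaqSmallOn (Sect2.omegaPlaqsTop Ω Ω₀ n) (B₃ * δ n * P.eta n ^ 2) U₀) ∧
      ∀ n, n ≤ k → Sect2.CoDivSmallOn (Sect2.omegaBondsTop Ω Ω₀ n) (B₃ * δ n * P.eta n ^ 3) U₀)
    (hρ : ∀ n, n ≤ k → B₃ * δ n ≤ ρ n) : ApproxMinTop av Ω Ω₀ k ρ W U₀ :=
  ApproxMinTop.of_le (ρ := fun n => B₃ * δ n) ⟨h8.1, h8.2, hagree⟩ hρ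

end Approx

/-! ## §2  The reductions -/

section Reductions

variable {F : T4Family} {N : ℕ} [NeZero N]
variable {Sup : (ν : Stage7Numerics) → (K : ℕ) → (ℕ → Set (Site (F.P K) 0)) → Set (Site (F.P K) 0)} {Adm Adm' : StepGuard F} {C₁ C₁' B₃ a₀ a₀' a₁ a₁' : ℝ}

/-- **★★ THE (E∕U) NAMED FACT FROM THE ONE-LENGTH STEP AND THE SUPPLY OF AN APPROXIMATE MINIMISER** — print's proof of Theorem 1 (existence ∕ uniqueness half) in one line:
at each `(s, W)` take the approximate minimiser the supply token provides and apply the step token to it.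
[cite: Balaban1985Variational, Thm 1 p.279, (14) p.280, Prop. 2 p.281, (141)–(142) p.299] -/
theorem variationalThm1EUSepTop7MG_of_step_of_approxExists (hstep : VariationalThm1EUStepTop7MG F N Sup Adm C₁ B₃ a₀ a₁)
    (hsup : ApproxMinimiserExistsTop7MG F N Sup Adm C₁ B₃ a₀ a₁) : VariationalThm1EUSepTop7MG F N Sup Adm B₃ a₀ a₁ := by
  intro ν M g K k s hk hsep hM₁ hAdm ε₀ δ hnum hc hc' hε W h7
  obtain ⟨U₀, hU₀⟩ := hsup ν M g K k s hk hsep hM₁ hAdm ε₀ δ hnum hc hc' hε W h7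
  exact hstep ν M g K k s hk hsep hM₁ hAdm ε₀ δ hnum hc hc' hε W h7 U₀ hU₀

/-- **★★ `CoP` EDITION**: the guard-generic (E∕U) name of record `VariationalThm1EUSepCoP7MG F N Adm B₃ a₀ a₁` (#10741; the input of N12's junction of record v14ᴸ) from the `CoP`
step token and the `CoP` supply token. [cite: Balaban1985Variational, Thm 1 p.279, (14) p.280, Prop. 2 p.281; Balaban1988Convergent, (2.12) p.256] -/
theorem variationalThm1EUSepCoP7MG_of_step_of_approxExists (hstep : VariationalThm1EUStepCoP7MG F N Adm C₁ B₃ a₀ a₁)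
    (hsup : ApproxMinimiserExistsCoP7MG F N Adm C₁ B₃ a₀ a₁) : VariationalThm1EUSepCoP7MG F N Adm B₃ a₀ a₁ :=
  variationalThm1EUSepTop7MG_of_step_of_approxExists hstep hsup

/-- **★ THE SUPPLY TOKEN FROM THE NAME AND (R)** (the converse bookkeeping): if minimisers exist (the (E∕U) name) and are `B₃δ_n`-regular (K0's guarded (R)-name
`Node00.VariationalThm1RegSepTop7MG`), then a minimiser itself is an approximate minimiser with (14) at every `C₁ ≥ 1` (`0 ≤ B₃`).  So MODULO the step token and (R) the name and the
supply token are EQUIVALENT (`variationalThm1EUSepTop7MG_iff_approxExists_of_step_of_reg`). [cite: Balaban1985Variational, Thm 1 (8) p.279, (13)–(14) p.280] -/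
theorem approxMinimiserExistsTop7MG_of_eu_of_reg (hEU : VariationalThm1EUSepTop7MG F N Sup Adm B₃ a₀ a₁) (hR : VariationalThm1RegSepTop7MG F N Sup Adm B₃ a₀ a₁)
    (hB₃ : 0 ≤ B₃) (hC₁ : 1 ≤ C₁) : ApproxMinimiserExistsTop7MG F N Sup Adm C₁ B₃ a₀ a₁ := by
  intro ν M g K k s hk hsep hM₁ hAdm ε₀ δ hnum hc hc' hε W h7
  obtain ⟨⟨U₀, hU₀⟩, -⟩ := hEU ν M g K k s hk hsep hM₁ hAdm ε₀ δ hnum hc hc' hε W h7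
  have h8 := hR ν M g K k s hsep hM₁ hAdm ε₀ δ hnum hc hc' hε W h7 U₀ hU₀
  refine ⟨U₀, approxMinTop_of_reg hU₀.2.1 h8 fun n hn => ?_⟩
  have hδ : 0 ≤ δ n := (hnum n hn).1.le
  calc B₃ * δ n = 1 * (B₃ * δ n) := (one_mul _).symm
    _ ≤ C₁ * (B₃ * δ n) := mul_le_mul_of_nonneg_right hC₁ (mul_nonneg hB₃ hδ)
    _ = C₁ * B₃ * δ n := (mul_assoc _ _ _).symm

/-- `CoP` edition of the converse bookkeeping. [cite: Balaban1985Variational, Thm 1 (8) p.279, (13)–(14) p.280; Balaban1988Convergent, (2.12) p.256] -/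
theorem approxMinimiserExistsCoP7MG_of_eu_of_reg (hEU : VariationalThm1EUSepCoP7MG F N Adm B₃ a₀ a₁) (hR : VariationalThm1RegSepCoP7MG F N Adm B₃ a₀ a₁)
    (hB₃ : 0 ≤ B₃) (hC₁ : 1 ≤ C₁) : ApproxMinimiserExistsCoP7MG F N Adm C₁ B₃ a₀ a₁ :=
  approxMinimiserExistsTop7MG_of_eu_of_reg hEU hR hB₃ hC₁

/-- **★ MODULO THE STEP TOKEN AND (R), THE (E∕U) NAME ⟺ THE SUPPLY TOKEN** (`C₁ ≥ 1`, `0 ≤ B₃`): the content of [15] Theorem 1's existence ∕ uniqueness half BEYOND the one-length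
analysis of Sects. A–E is exactly the supply of approximate minimisers — print's induction (11)–(13). [cite: Balaban1985Variational, Thm 1 p.279, (11) p.279, (12)–(14) p.280, Prop. 2 p.281] -/
theorem variationalThm1EUSepTop7MG_iff_approxExists_of_step_of_reg (hstep : VariationalThm1EUStepTop7MG F N Sup Adm C₁ B₃ a₀ a₁)
    (hR : VariationalThm1RegSepTop7MG F N Sup Adm B₃ a₀ a₁) (hB₃ : 0 ≤ B₃) (hC₁ : 1 ≤ C₁) :
    VariationalThm1EUSepTop7MG F N Sup Adm B₃ a₀ a₁ ↔ ApproxMinimiserExistsTop7MG F N Sup Adm C₁ B₃ a₀ a₁ :=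
  ⟨fun hEU => approxMinimiserExistsTop7MG_of_eu_of_reg hEU hR hB₃ hC₁, fun hsup => variationalThm1EUSepTop7MG_of_step_of_approxExists hstep hsup⟩

/-- `CoP` edition of the equivalence. [cite: Balaban1985Variational, Thm 1 p.279, (11)–(14) pp.279–280; Balaban1988Convergent, (2.12) p.256] -/
theorem variationalThm1EUSepCoP7MG_iff_approxExists_of_step_of_reg (hstep : VariationalThm1EUStepCoP7MG F N Adm C₁ B₃ a₀ a₁)
    (hR : VariationalThm1RegSepCoP7MG F N Adm B₃ a₀ a₁) (hB₃ : 0 ≤ B₃) (hC₁ : 1 ≤ C₁) :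
    VariationalThm1EUSepCoP7MG F N Adm B₃ a₀ a₁ ↔ ApproxMinimiserExistsCoP7MG F N Adm C₁ B₃ a₀ a₁ :=
  variationalThm1EUSepTop7MG_iff_approxExists_of_step_of_reg hstep hR hB₃ hC₁

/-! ### bookkeeping: guard, ceilings, the constant `C₁` -/

/-- The step token is ANTITONE IN THE GUARD (a weaker guard admits more indices). [cite: Balaban1985Variational, Prop. 2 p.281 (bookkeeping)] -/
theorem VariationalThm1EUStepTop7MG.anti (h : VariationalThm1EUStepTop7MG F N Sup Adm C₁ B₃ a₀ a₁) (hAdm : ∀ ν M g K k s, Adm' ν M g K k s → Adm ν M g K k s) :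
    VariationalThm1EUStepTop7MG F N Sup Adm' C₁ B₃ a₀ a₁ :=
  fun ν M g K k s hk hsep hM₁ hAdm' => h ν M g K k s hk hsep hM₁ (hAdm ν M g K k s hAdm')

/-- `CoP`: antitone in the guard. [cite: Balaban1985Variational, Prop. 2 p.281 (bookkeeping)] -/
theorem VariationalThm1EUStepCoP7MG.anti (h : VariationalThm1EUStepCoP7MG F N Adm C₁ B₃ a₀ a₁) (hAdm : ∀ ν M g K k s, Adm' ν M g K k s → Adm ν M g K k s) :
    VariationalThm1EUStepCoP7MG F N Adm' C₁ B₃ a₀ a₁ :=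
  VariationalThm1EUStepTop7MG.anti h hAdm

/-- The step token is antitone in the ceilings `a₀`, `a₁`. [cite: Balaban1985Variational, Thm 1 p.279 (the range «ε₀ ≤ a₀», «ε₁ ≤ a₁»; bookkeeping)] -/
theorem VariationalThm1EUStepTop7MG.of_le (h : VariationalThm1EUStepTop7MG F N Sup Adm C₁ B₃ a₀ a₁) (ha₀ : a₀' ≤ a₀) (ha₁ : a₁' ≤ a₁) :
    VariationalThm1EUStepTop7MG F N Sup Adm C₁ B₃ a₀' a₁' :=
  fun ν M g K k s hk hsep hM₁ hAdm ε₀ δ hnum hc hc' hε =>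
    h ν M g K k s hk hsep hM₁ hAdm ε₀ δ (fun n hn => ⟨(hnum n hn).1, (hnum n hn).2.1.trans ha₁, (hnum n hn).2.2⟩) hc hc' (hε.trans ha₀)

/-- `CoP`: antitone in the ceilings. [cite: Balaban1985Variational, Thm 1 p.279 (bookkeeping)] -/
theorem VariationalThm1EUStepCoP7MG.of_le (h : VariationalThm1EUStepCoP7MG F N Adm C₁ B₃ a₀ a₁) (ha₀ : a₀' ≤ a₀) (ha₁ : a₁' ≤ a₁) :
    VariationalThm1EUStepCoP7MG F N Adm C₁ B₃ a₀' a₁' :=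
  VariationalThm1EUStepTop7MG.of_le h ha₀ ha₁

/-- The step token is ANTITONE IN `C₁` (a larger `C₁` admits more approximate minimisers; `0 ≤ B₃`). [cite: Balaban1985Variational, (14) p.280 (bookkeeping)] -/
theorem VariationalThm1EUStepTop7MG.of_C₁_le (h : VariationalThm1EUStepTop7MG F N Sup Adm C₁ B₃ a₀ a₁) (hB₃ : 0 ≤ B₃) (hC : C₁' ≤ C₁) :
    VariationalThm1EUStepTop7MG F N Sup Adm C₁' B₃ a₀ a₁ :=
  fun ν M g K k s hk hsep hM₁ hAdm ε₀ δ hnum hc hc' hε W h7 U₀ hU₀ =>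
    h ν M g K k s hk hsep hM₁ hAdm ε₀ δ hnum hc hc' hε W h7 U₀
      (hU₀.of_le fun n hn => by
        have hδ : 0 ≤ δ n := (hnum n hn).1.le
        calc C₁' * B₃ * δ n = C₁' * (B₃ * δ n) := mul_assoc _ _ _
          _ ≤ C₁ * (B₃ * δ n) := mul_le_mul_of_nonneg_right hC (mul_nonneg hB₃ hδ)
          _ = C₁ * B₃ * δ n := (mul_assoc _ _ _).symm)

/-- `CoP`: antitone in `C₁`. [cite: Balaban1985Variational, (14) p.280 (bookkeeping)] -/
theorem VariationalThm1EUStepCoP7MG.of_C₁_le (h : VariationalThm1EUStepCoP7MG F N Adm C₁ B₃ a₀ a₁) (hB₃ : 0 ≤ B₃) (hC : C₁' ≤ C₁) :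
    VariationalThm1EUStepCoP7MG F N Adm C₁' B₃ a₀ a₁ :=
  VariationalThm1EUStepTop7MG.of_C₁_le h hB₃ hC

/-- The supply token is MONOTONE IN `C₁` (`0 ≤ B₃`). [cite: Balaban1985Variational, (14) p.280 (bookkeeping)] -/
theorem ApproxMinimiserExistsTop7MG.mono (h : ApproxMinimiserExistsTop7MG F N Sup Adm C₁ B₃ a₀ a₁) (hB₃ : 0 ≤ B₃) (hC : C₁ ≤ C₁') :
    ApproxMinimiserExistsTop7MG F N Sup Adm C₁' B₃ a₀ a₁ := by
  intro ν M g K k s hk hsep hM₁ hAdm ε₀ δ hnum hc hc' hε W h7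
  obtain ⟨U₀, hU₀⟩ := h ν M g K k s hk hsep hM₁ hAdm ε₀ δ hnum hc hc' hε W h7
  refine ⟨U₀, hU₀.of_le fun n hn => ?_⟩
  have hδ : 0 ≤ δ n := (hnum n hn).1.le
  calc C₁ * B₃ * δ n = C₁ * (B₃ * δ n) := mul_assoc _ _ _
    _ ≤ C₁' * (B₃ * δ n) := mul_le_mul_of_nonneg_right hC (mul_nonneg hB₃ hδ)
    _ = C₁' * B₃ * δ n := (mul_assoc _ _ _).symm

/-- `CoP`: the supply token is monotone in `C₁`. [cite: Balaban1985Variational, (14) p.280 (bookkeeping)] -/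
theorem ApproxMinimiserExistsCoP7MG.mono (h : ApproxMinimiserExistsCoP7MG F N Adm C₁ B₃ a₀ a₁) (hB₃ : 0 ≤ B₃) (hC : C₁ ≤ C₁') :
    ApproxMinimiserExistsCoP7MG F N Adm C₁' B₃ a₀ a₁ :=
  ApproxMinimiserExistsTop7MG.mono h hB₃ hC

/-- The supply token is antitone in the guard. [cite: Balaban1985Variational, (14) p.280 (bookkeeping)] -/
theorem ApproxMinimiserExistsTop7MG.anti (h : ApproxMinimiserExistsTop7MG F N Sup Adm C₁ B₃ a₀ a₁) (hAdm : ∀ ν M g K k s, Adm' ν M g K k s → Adm ν M g K k s) :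
    ApproxMinimiserExistsTop7MG F N Sup Adm' C₁ B₃ a₀ a₁ :=
  fun ν M g K k s hk hsep hM₁ hAdm' => h ν M g K k s hk hsep hM₁ (hAdm ν M g K k s hAdm')

/-- `CoP`: the supply token is antitone in the guard. [cite: Balaban1985Variational, (14) p.280 (bookkeeping)] -/
theorem ApproxMinimiserExistsCoP7MG.anti (h : ApproxMinimiserExistsCoP7MG F N Adm C₁ B₃ a₀ a₁) (hAdm : ∀ ν M g K k s, Adm' ν M g K k s → Adm ν M g K k s) :
    ApproxMinimiserExistsCoP7MG F N Adm' C₁ B₃ a₀ a₁ :=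
  ApproxMinimiserExistsTop7MG.anti h hAdm

end Reductions

end Literature.MathematicalPhysics.QuantumFieldTheory.Balaban1983to89.B11Thm1ExistsUniqueStepTokensG

end
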